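import Summits.AtomisticToContinuum.BoseEinsteinCondensation.Theses.BECLatticeDepthHomotopy
import Summits.AtomisticToContinuum.BoseEinsteinCondensation.Theorems.BECLatticeDepthHomotopyModeIdentificationOccupationLipschitz
import Summits.AtomisticToContinuum.BoseEinsteinCondensation.Theorems.BECLatticeDepthHomotopyModeIdentificationSchurBound
import Summits.AtomisticToContinuum.BoseEinsteinCondensation.Theorems.BECInsertionCorrectorCorrectorClosureNearMinimiserRigidityFrame
import Summits.AtomisticToContinuum.BoseEinsteinCondensation.Theorems.BECInsertionCorrectorCorrectorClosureFKTranslate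
import Summits.AtomisticToContinuum.BoseEinsteinCondensation.Theorems.BECConjugateDominationHardCoreExtensionBoundedPositiveMinimiser
import Literature.MathematicalPhysics.QuantumManyBody.PeriodicGroundStateFeynmanKacProofs
import HarnessLib

/-!
# Route `BECLatticeDepthHomotopy`, support item `ModeIdentification` (stmt-AtomisticToContinuum-12408):
# the mode-free and the constant-mode ground-state condensate numbers agree — proved for every
# repulsive finite-range pair potential that is BOUNDED, and reduced in general to the rigidity of a
# non-negative translation-invariant ground state

Helper file (supports, does not close, stmt-AtomisticToContinuum-12408). The item reads, at `c = 0`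
(no optical lattice), `Λ(0) ≤ periodicCondensateNumber v N L` for `N = 4m³`, all large `m` and all
small densities, where

  `Λ(0) = sup_{δ>0} inf {λ_max(γ_Ψ) : Ψ periodic C¹ Bose state, 𝓔^per[Ψ] ≤ E₀ + δ}`,
  `periodicCondensateNumber = sup_{δ>0} inf {⟨Ψ, n₀Ψ⟩ : 𝓔^per[Ψ] ≤ E₀ + δ}`,

`λ_max(γ_Ψ) = maxOccupation N (1_{cell^N}Ψ)` (mode-free) and `⟨Ψ, n₀Ψ⟩ = condensateOccupation N L Ψ`
(constant mode). Pointwise `λ_max ≥ n₀`, so the typed direction is the non-trivial one; it holds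
because BOTH functionals converge along near-minimisers to their value at the ground state `Ψ₀`, where
they coincide. This file proves:

* `iSup_iInf_maxOccupation_le_periodicCondensateNumber_of_rigid` — **the reduction**, at fixed
  `(N, L)` and for ANY `v`: if some continuous `Ψ₀ ≥ 0`, `Lℤ³`-periodic, invariant under common
  translations, with `∫_cell Ψ₀² ≤ 1`, is RIGID for `v` (every `δ(η)`-near-minimiser is within `η` of
  `αΨ₀` in `L²(cell)` for some `|α| ≤ 1`), then `Λ(0) ≤ periodicCondensateNumber v N L`. Proof: pick a
  `δ'`-near-minimiser `Ψ'` almost realising the `n₀`-infimum (`δ' ≤ δ, δ(η)`); then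
  `inf_{S_δ} λ_max ≤ λ_max(Ψ') ≤ λ_max(αΨ₀) + N(2η+η²)` (`maxOccupation_indicator_le_of_sub_le`)
  `= |α|² λ_max(Ψ₀) + … ≤ |α|² n₀(Ψ₀) + …` (**Schur bound** `maxOccupation_indicator_le_condensateOccupation`)
  `= n₀(αΨ₀) + … ≤ n₀(Ψ') + 2N(2η+η²)` (`condensateOccupation_le_of_sub_le`)
  `≤ periodicCondensateNumber + ε`.
* `exists_rigid_of_bounded` — for `v` repulsive finite-range and BOUNDED (`v ≤ M < ∞`), every
  `N ≥ 1`, `L > 0`: the torus Feynman–Kac ground state `periodicFKGroundState v N L` is such a `Ψ₀`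
  (Perron–Frobenius package `PeriodicGroundStateFeynmanKac_holds`, translation invariance
  `fkGroundState_translate_eq`, rigidity of near-minimisers `rigidity_of_nearMinimiser`).
* `iSup_iInf_maxOccupation_le_periodicCondensateNumber` — hence the inequality for bounded `v`, ALL
  `N ≥ 1` and `L > 0` (no dilution needed);
* `modeIdentification_of_bounded` — the route decl's `v`-clause verbatim, for bounded `v`;
* `modeIdentification_clause_of_rigid`, `modeIdentification_of_rigid` — the `v`-clause, resp.
  `ModeIdentification` itself, CONDITIONAL on the existence of a rigid non-negative translation-invariant
  ground state at `N = 4m³`, `L = (N/ρ)^{1/3}`, eventually in `m`, for `ρ < ρ₁(v)`;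
* `modeIdentification_of_rigid_unbounded` — the same with the hypothesis restricted to the `v` that are
  NOT bounded (hard cores `v = ⊤` on a set of radii, or finite unbounded profiles): the exact residual
  input for the item (uniqueness / Perron–Frobenius for the periodic ground state beyond bounded `v^per`,
  e.g. on the dilute hard-sphere torus, is not in the tree).

References: E. H. Lieb, R. Seiringer, J. P. Solovej, J. Yngvason (2005), §1.2 (1.17)–(1.19) [LSSY2005];
O. Penrose, L. Onsager, Phys. Rev. 104 (1956) 576, §4 [PenroseOnsager1956]; M. Reed, B. Simon, *Methods
of Modern Mathematical Physics IV* (1978), §XIII.12 [ReedSimonIV1978].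
-/

noncomputable section

namespace Summit.AtomisticToContinuum.BoseEinsteinCondensation.Theorems.ModeIdentification

open MeasureTheory Filter
open scoped ENNReal NNReal Topology ComplexConjugate
open Literature.MathematicalPhysics.QuantumManyBody.BoseGas
open Literature.Barriers.AtomisticToContinuum.BoseGas (periodicCondensateNumber le_periodicCondensateNumber)
open Summit.AtomisticToContinuum.BoseEinsteinCondensation.Theorems.CorrectorClosure.HealingScaleKacInsertion
  (rigidity_of_nearMinimiser fkGroundState_translate_eq)
open Summit.AtomisticToContinuum.BoseEinsteinCondensation.Cruxes.HardCoreExtension.ThirdLawCurrentFloor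
  (exists_periodizedPotential_le)

variable {n : ℕ} {L : ℝ}

/-! ### The reduction to a rigid non-negative translation-invariant ground state -/

/-- Error budget: for `e > 0` and `N ≥ 1` there is `0 < t ≤ 1` with `N(2t + t²) ≤ e`. [folklore] -/
theorem exists_errorBudget (N : ℕ) {e : ℝ} (he : 0 < e) :
    ∃ t : ℝ, 0 < t ∧ (N : ℝ) * (2 * t + t ^ 2) ≤ e := by
  set Nr : ℝ := (N : ℝ) + 1 with hNr
  have hN0 : 0 < Nr := by positivity
  refine ⟨min 1 (e / (3 * Nr)), lt_min one_pos (by positivity), ?_⟩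
  set t : ℝ := min 1 (e / (3 * Nr)) with ht
  have ht0 : 0 ≤ t := (lt_min one_pos (by positivity : 0 < e / (3 * Nr))).le
  have ht1 : t ≤ 1 := min_le_left _ _
  have hte : t ≤ e / (3 * Nr) := min_le_right _ _
  have h1 : t ^ 2 ≤ t := by nlinarith
  have hNle : (N : ℝ) ≤ Nr := by rw [hNr]; linarith
  calc (N : ℝ) * (2 * t + t ^ 2) ≤ Nr * (3 * t) := by
        have : 2 * t + t ^ 2 ≤ 3 * t := by linarith
        exact mul_le_mul hNle this (add_nonneg (by linarith) (sq_nonneg t)) hN0.le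
    _ ≤ Nr * (3 * (e / (3 * Nr))) := by gcongr
    _ = e := by
        rw [show Nr * (3 * (e / (3 * Nr))) = (3 * Nr) * (e / (3 * Nr)) by ring]
        exact mul_div_cancel₀ e (by positivity)

/-- **The reduction (fixed `N = n+1`, `L > 0`, any `v`).** Suppose `Ψ₀ : (ℝ³)^{n+1} → ℝ` is
continuous, non-negative, `Lℤ³`-periodic in every particle, invariant under common translations
`X ↦ X + (u,…,u)`, with `∫_cell Ψ₀² ≤ 1`, and RIGID for `v`: for every `η > 0` there is `δ > 0` such
that every periodic `C¹` Bose state `Ψ` with `𝓔^per_v[Ψ] ≤ E₀ + δ` satisfies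
`∫_cell |Ψ - αΨ₀|² ≤ η` for some `|α| ≤ 1`. Then the mode-free ground-state condensate number is at
most the constant-mode one:
`sup_{δ>0} inf_{𝓔[Ψ] ≤ E₀+δ} λ_max(γ_Ψ) ≤ periodicCondensateNumber v (n+1) L`.
[cite: LSSY2005, §1.2 (1.17)–(1.19)] -/
theorem iSup_iInf_maxOccupation_le_periodicCondensateNumber_of_rigid (v : ℝ → ℝ≥0∞) (hL : 0 < L)
    {Ψ₀ : Config (n + 1) → ℝ} (hcont : Continuous Ψ₀) (hnn : ∀ X, 0 ≤ Ψ₀ X)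
    (hper : ∀ (X : Config (n + 1)) (i : Fin (n + 1)) (k : Fin 3),
      Ψ₀ (X + Pi.single i (EuclideanSpace.single k L)) = Ψ₀ X)
    (htrans : ∀ (u : Space) (X : Config (n + 1)), Ψ₀ (X + fun _ => u) = Ψ₀ X)
    (hnorm : ∫⁻ X in cellN (n + 1) L, ENNReal.ofReal (Ψ₀ X) ^ 2 ≤ 1)
    (hrig : ∀ η : ℝ, 0 < η → ∃ δ : ℝ, 0 < δ ∧ ∀ Ψ : PeriodicTrialState (n + 1) L,
      periodicEnergy v Ψ ≤ periodicGroundStateEnergy v (n + 1) L + ENNReal.ofReal δ →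
        ∃ α : ℂ, ‖α‖ ≤ 1 ∧
          ∫⁻ X in cellN (n + 1) L, (‖Ψ.ψ X - α * Ψ₀ X‖₊ : ℝ≥0∞) ^ 2 ≤ ENNReal.ofReal η) :
    (⨆ (δ : ℝ≥0∞) (_ : 0 < δ), ⨅ (Ψ : PeriodicTrialState (n + 1) L)
      (_ : periodicEnergy v Ψ ≤ periodicGroundStateEnergy v (n + 1) L + δ),
        maxOccupation (n + 1) ((cellN (n + 1) L).indicator Ψ.ψ)) ≤
      periodicCondensateNumber v (n + 1) L := by
  -- the comparison state `F = Ψ₀` read as a complex function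
  have hnormF : ∀ X, ‖((Ψ₀ X : ℝ) : ℂ)‖ = Ψ₀ X := fun X => by
    rw [Complex.norm_real, Real.norm_eq_abs, abs_of_nonneg (hnn X)]
  have hennF : ∀ X, (‖((Ψ₀ X : ℝ) : ℂ)‖₊ : ℝ≥0∞) = ENNReal.ofReal (Ψ₀ X) := fun X => by
    rw [← enorm_eq_nnnorm, ← ofReal_norm, hnormF]
  have hFc : Continuous fun X => ((Ψ₀ X : ℝ) : ℂ) := Complex.continuous_ofReal.comp hcont
  have hreal : ∀ X, ((Ψ₀ X : ℝ) : ℂ) = (‖((Ψ₀ X : ℝ) : ℂ)‖ : ℂ) := fun X => by rw [hnormF]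
  have hperF : ∀ (X : Config (n + 1)) (i : Fin (n + 1)) (k : Fin 3),
      ((Ψ₀ (X + Pi.single i (EuclideanSpace.single k L)) : ℝ) : ℂ) = ((Ψ₀ X : ℝ) : ℂ) :=
    fun X i k => by rw [hper]
  have htransF : ∀ (u : Space) (X : Config (n + 1)),
      ((Ψ₀ (X + fun _ => u) : ℝ) : ℂ) = ((Ψ₀ X : ℝ) : ℂ) := fun u X => by rw [htrans]
  have hF1 : ∫⁻ X in cellN (n + 1) L, (‖((Ψ₀ X : ℝ) : ℂ)‖₊ : ℝ≥0∞) ^ 2 ≤ 1 := by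
    simp_rw [hennF]; exact hnorm
  -- Schur bound at the ground state: `λ_max(Ψ₀) ≤ n₀(Ψ₀)`
  have hSchur := maxOccupation_indicator_le_condensateOccupation hL hFc hreal hperF htransF
  -- reduce to `∀ ε > 0`
  refine iSup₂_le fun δ hδ => ?_
  refine ENNReal.le_of_forall_pos_le_add fun ε hε hfin => ?_
  -- error budget `ε = ε/3 + ε/3 + ε/3`
  have hε3 : (0 : ℝ) < (ε : ℝ) / 3 := div_pos (NNReal.coe_pos.2 hε) (by norm_num)
  have hε3' : ENNReal.ofReal ((ε : ℝ) / 3) = (ε : ℝ≥0∞) / 3 := by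
    rw [ENNReal.ofReal_div_of_pos (by norm_num : (0 : ℝ) < 3), ENNReal.ofReal_coe_nnreal,
      ENNReal.ofReal_ofNat]
  have hε3pos : (0 : ℝ≥0∞) < (ε : ℝ≥0∞) / 3 := by rw [← hε3']; exact ENNReal.ofReal_pos.2 hε3
  obtain ⟨t, ht0, hterr⟩ := exists_errorBudget (n + 1) hε3
  have herr : ENNReal.ofReal (((n + 1 : ℕ) : ℝ) * (2 * t + t ^ 2)) ≤ (ε : ℝ≥0∞) / 3 :=
    (ENNReal.ofReal_le_ofReal hterr).trans_eq hε3'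
  -- the rigidity slack for `η = t²`, and the working slack `δ' = min δ δ_t`
  obtain ⟨δt, hδt, hrigt⟩ := hrig (t ^ 2) (by positivity)
  set δ' : ℝ≥0∞ := min δ (ENNReal.ofReal δt) with hδ'
  have hδ'0 : 0 < δ' := lt_min hδ (ENNReal.ofReal_pos.2 hδt)
  -- a `δ'`-near-minimiser almost realising the `n₀`-infimum
  have hb : (⨅ (Ψ : PeriodicTrialState (n + 1) L)
      (_ : periodicEnergy v Ψ ≤ periodicGroundStateEnergy v (n + 1) L + δ'),
        condensateOccupation (n + 1) L Ψ.ψ) ≤ periodicCondensateNumber v (n + 1) L :=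
    le_periodicCondensateNumber v hδ'0 fun Ψ hΨ => iInf₂_le Ψ hΨ
  have hblt : (⨅ (Ψ : PeriodicTrialState (n + 1) L)
      (_ : periodicEnergy v Ψ ≤ periodicGroundStateEnergy v (n + 1) L + δ'),
        condensateOccupation (n + 1) L Ψ.ψ) < periodicCondensateNumber v (n + 1) L + (ε : ℝ≥0∞) / 3 :=
    lt_of_le_of_lt hb (ENNReal.lt_add_right hfin.ne hε3pos.ne')
  obtain ⟨Ψ', hΨ'⟩ := iInf_lt_iff.1 hblt
  obtain ⟨hΨ'E, hΨ'n⟩ := iInf_lt_iff.1 hΨ'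
  have hΨ'δ : periodicEnergy v Ψ' ≤ periodicGroundStateEnergy v (n + 1) L + δ :=
    hΨ'E.trans (add_le_add le_rfl (min_le_left _ _))
  have hΨ't : periodicEnergy v Ψ' ≤ periodicGroundStateEnergy v (n + 1) L + ENNReal.ofReal δt :=
    hΨ'E.trans (add_le_add le_rfl (min_le_right _ _))
  -- rigidity: `Ψ'` is `t`-close to `αΨ₀`
  obtain ⟨α, hα1, hclose⟩ := hrigt Ψ' hΨ't
  have hgc : Continuous fun X => α * ((Ψ₀ X : ℝ) : ℂ) := continuous_const.mul hFc
  have hαe : (‖α‖₊ : ℝ≥0∞) ^ 2 ≤ 1 := by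
    refine pow_le_one₀ zero_le ?_
    exact_mod_cast hα1
  have hg1 : ∫⁻ X in cellN (n + 1) L, (‖α * ((Ψ₀ X : ℝ) : ℂ)‖₊ : ℝ≥0∞) ^ 2 ≤ 1 := by
    have hX : ∀ X, (‖α * ((Ψ₀ X : ℝ) : ℂ)‖₊ : ℝ≥0∞) ^ 2 =
        (‖α‖₊ : ℝ≥0∞) ^ 2 * (‖((Ψ₀ X : ℝ) : ℂ)‖₊ : ℝ≥0∞) ^ 2 := fun X => by
      rw [nnnorm_mul, ENNReal.coe_mul, mul_pow]
    simp_rw [hX]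
    rw [lintegral_const_mul' _ _ (ENNReal.pow_ne_top ENNReal.coe_ne_top)]
    calc (‖α‖₊ : ℝ≥0∞) ^ 2 * ∫⁻ X in cellN (n + 1) L, (‖((Ψ₀ X : ℝ) : ℂ)‖₊ : ℝ≥0∞) ^ 2
        ≤ 1 * 1 := mul_le_mul' hαe hF1
      _ = 1 := one_mul _
  have hclose' : ∫⁻ X in cellN (n + 1) L, (‖α * ((Ψ₀ X : ℝ) : ℂ) - Ψ'.ψ X‖₊ : ℝ≥0∞) ^ 2 ≤
      ENNReal.ofReal (t ^ 2) := by
    have hX : ∀ X, ‖α * ((Ψ₀ X : ℝ) : ℂ) - Ψ'.ψ X‖₊ = ‖Ψ'.ψ X - α * ((Ψ₀ X : ℝ) : ℂ)‖₊ := fun X => by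
      rw [← nnnorm_neg, neg_sub]
    simp_rw [hX]; exact hclose
  -- `λ_max(Ψ') ≤ λ_max(αΨ₀) + N(2t+t²)`
  have h1 := maxOccupation_indicator_le_of_sub_le L Ψ'.contDiff.continuous hgc hg1 ht0 hclose
  -- `λ_max(αΨ₀) = |α|² λ_max(Ψ₀) ≤ |α|² n₀(Ψ₀) = n₀(αΨ₀)`
  have h2 : maxOccupation (n + 1) ((cellN (n + 1) L).indicator fun X => α * ((Ψ₀ X : ℝ) : ℂ)) ≤
      condensateOccupation (n + 1) L fun X => α * ((Ψ₀ X : ℝ) : ℂ) := by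
    rw [maxOccupation_indicator_const_mul,
      Literature.MathematicalPhysics.QuantumManyBody.BoseGas.condensateOccupation_const_mul]
    exact mul_le_mul_right hSchur _
  -- `n₀(αΨ₀) ≤ n₀(Ψ') + N(2t+t²)`
  have h3 := condensateOccupation_le_of_sub_le hL hgc Ψ'.contDiff.continuous Ψ'.norm_eq.le ht0 hclose'
  -- chain
  calc (⨅ (Ψ : PeriodicTrialState (n + 1) L)
        (_ : periodicEnergy v Ψ ≤ periodicGroundStateEnergy v (n + 1) L + δ),
          maxOccupation (n + 1) ((cellN (n + 1) L).indicator Ψ.ψ))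
      ≤ maxOccupation (n + 1) ((cellN (n + 1) L).indicator Ψ'.ψ) := iInf₂_le Ψ' hΨ'δ
    _ ≤ maxOccupation (n + 1) ((cellN (n + 1) L).indicator fun X => α * ((Ψ₀ X : ℝ) : ℂ)) +
          ENNReal.ofReal (((n + 1 : ℕ) : ℝ) * (2 * t + t ^ 2)) := h1
    _ ≤ condensateOccupation (n + 1) L (fun X => α * ((Ψ₀ X : ℝ) : ℂ)) +
          ENNReal.ofReal (((n + 1 : ℕ) : ℝ) * (2 * t + t ^ 2)) := by gcongr
    _ ≤ condensateOccupation (n + 1) L Ψ'.ψ + ENNReal.ofReal (((n + 1 : ℕ) : ℝ) * (2 * t + t ^ 2)) +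
          ENNReal.ofReal (((n + 1 : ℕ) : ℝ) * (2 * t + t ^ 2)) := by gcongr
    _ ≤ (periodicCondensateNumber v (n + 1) L + (ε : ℝ≥0∞) / 3) + (ε : ℝ≥0∞) / 3 + (ε : ℝ≥0∞) / 3 :=
          add_le_add (add_le_add hΨ'n.le herr) herr
    _ = periodicCondensateNumber v (n + 1) L + ε := by
          rw [add_assoc, add_assoc, ← add_assoc ((ε : ℝ≥0∞) / 3), ENNReal.add_thirds]

/-! ### Bounded potentials: the Feynman–Kac ground state is rigid -/

/-- **For a bounded repulsive finite-range pair potential the torus Feynman–Kac ground state is a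
rigid non-negative translation-invariant ground state** (`N ≥ 1`, `L > 0`): `periodicFKGroundState`
is continuous, strictly positive, periodic, Bose symmetric and cell-normalised
(`PeriodicGroundStateFeynmanKac_holds`, Perron–Frobenius for the positivity improving semigroup),
invariant under common translations (`fkGroundState_translate_eq`, uniqueness), and near-minimisers
are rigid around it (`rigidity_of_nearMinimiser`, spectral gap below the simple top eigenvalue of
`e^{-H}`). [cite: ReedSimonIV1978, §XIII.12 Thms XIII.43–XIII.46] -/
theorem exists_rigid_of_bounded {v : ℝ → ℝ≥0∞} (hv : IsRepulsiveFiniteRange v)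
    (hM : ∃ M : ℝ≥0∞, M ≠ ⊤ ∧ ∀ r, v r ≤ M) (n : ℕ) (hL : 0 < L) :
    ∃ Ψ₀ : Config (n + 1) → ℝ, Continuous Ψ₀ ∧ (∀ X, 0 ≤ Ψ₀ X) ∧
      (∀ (X : Config (n + 1)) (i : Fin (n + 1)) (k : Fin 3),
        Ψ₀ (X + Pi.single i (EuclideanSpace.single k L)) = Ψ₀ X) ∧
      (∀ (u : Space) (X : Config (n + 1)), Ψ₀ (X + fun _ => u) = Ψ₀ X) ∧
      (∫⁻ X in cellN (n + 1) L, ENNReal.ofReal (Ψ₀ X) ^ 2 ≤ 1) ∧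
      (∀ η : ℝ, 0 < η → ∃ δ : ℝ, 0 < δ ∧ ∀ Ψ : PeriodicTrialState (n + 1) L,
        periodicEnergy v Ψ ≤ periodicGroundStateEnergy v (n + 1) L + ENNReal.ofReal δ →
          ∃ α : ℂ, ‖α‖ ≤ 1 ∧
            ∫⁻ X in cellN (n + 1) L, (‖Ψ.ψ X - α * Ψ₀ X‖₊ : ℝ≥0∞) ^ 2 ≤ ENNReal.ofReal η) := by
  obtain ⟨C, hC⟩ := exists_periodizedPotential_le hv hM hL
  obtain ⟨hΨ, hcont, hpos⟩ := PeriodicGroundStateFeynmanKac_holds.periodicFKGroundState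
    (N := n + 1) (Nat.succ_le_succ (Nat.zero_le n)) hL hv.1 ⟨C, hC⟩
  refine ⟨periodicFKGroundState v (n + 1) L, hcont, hΨ.nonneg, hΨ.periodic,
    fun u X => fkGroundState_translate_eq hv.1 hL hΨ u X, hΨ.norm_eq.le, fun η hη => ?_⟩
  obtain ⟨δ, hδ, hrig⟩ := rigidity_of_nearMinimiser hv.1 hL hC hΨ hcont hpos hη
  exact ⟨δ, hδ, fun Ψ hΨE => by
    obtain ⟨α, hα1, -, hclose⟩ := hrig Ψ hΨE
    exact ⟨α, hα1, hclose⟩⟩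

/-- **Mode identification for bounded potentials, at every `(N, L)`**: for `v` repulsive
finite-range with `v ≤ M < ∞`, `N = n + 1 ≥ 1` and `L > 0`,
`sup_{δ>0} inf_{𝓔[Ψ] ≤ E₀+δ} λ_max(γ_Ψ) ≤ periodicCondensateNumber v (n+1) L` — the mode-free
ground-state condensate number is the constant-mode one (the reverse inequality being pointwise).
[cite: LSSY2005, §1.2 (1.17)–(1.19)] -/
theorem iSup_iInf_maxOccupation_le_periodicCondensateNumber {v : ℝ → ℝ≥0∞}
    (hv : IsRepulsiveFiniteRange v) (hM : ∃ M : ℝ≥0∞, M ≠ ⊤ ∧ ∀ r, v r ≤ M) (n : ℕ) (hL : 0 < L) :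
    (⨆ (δ : ℝ≥0∞) (_ : 0 < δ), ⨅ (Ψ : PeriodicTrialState (n + 1) L)
      (_ : periodicEnergy v Ψ ≤ periodicGroundStateEnergy v (n + 1) L + δ),
        maxOccupation (n + 1) ((cellN (n + 1) L).indicator Ψ.ψ)) ≤
      periodicCondensateNumber v (n + 1) L := by
  obtain ⟨Ψ₀, hcont, hnn, hper, htrans, hnorm, hrig⟩ := exists_rigid_of_bounded hv hM n hL
  exact iSup_iInf_maxOccupation_le_periodicCondensateNumber_of_rigid v hL hcont hnn hper htrans
    hnorm hrig

/-! ### The route's reading -/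

/-- `4m³ = (4m³ - 1) + 1` for `m ≥ 1`. [folklore] -/
theorem four_mul_pow_three_eq_succ {m : ℕ} (hm : 1 ≤ m) : 4 * m ^ 3 = (4 * m ^ 3 - 1) + 1 := by
  have h : 1 ≤ 4 * m ^ 3 :=
    Nat.one_le_iff_ne_zero.2 (Nat.mul_ne_zero (by norm_num) (pow_ne_zero 3 (by omega)))
  exact (Nat.sub_add_cancel h).symm

/-- The box of the route has positive side: `(4m³/ρ)^{1/3} > 0` for `ρ > 0`, `m ≥ 1`. [folklore] -/
theorem sideLength_pos_of {ρ : ℝ} (hρ : 0 < ρ) {m : ℕ} (hm : 1 ≤ m) : 0 < sideLength ρ (4 * m ^ 3) := by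
  have hN : 0 < 4 * m ^ 3 := by rw [four_mul_pow_three_eq_succ hm]; exact Nat.succ_pos _
  unfold sideLength
  exact Real.rpow_pos_of_pos (div_pos (Nat.cast_pos.2 hN) hρ) _

/-- **`ModeIdentification` for BOUNDED potentials** — the `v`-clause of the route decl
`Summit.AtomisticToContinuum.BoseEinsteinCondensation.Theses.BECLatticeDepthHomotopy.ModeIdentification`
verbatim, under the extra hypothesis `v ≤ M < ∞`: with `ρ₁ = 1` (any density) and all `m ≥ 1`,
`Λ(0) ≤ periodicCondensateNumber v (4m³) ((4m³/ρ)^{1/3})`. The depth-`0` energy of the route is the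
periodic energy (`ofReal 0 · ∫ W|Ψ|² = 0` in `[0, ∞]`, even when the lattice integral is infinite), so
its infimum is `periodicGroundStateEnergy` and `Λ(0)` is the mode-free functional of
`iSup_iInf_maxOccupation_le_periodicCondensateNumber`. What remains for the unconditional item is the
same statement for unbounded `v` (hard cores), i.e. a rigid non-negative translation-invariant periodic
ground state there (`modeIdentification_of_rigid`). [cite: LSSY2005, §1.2 (1.17)–(1.19)] -/
theorem modeIdentification_of_bounded (v : ℝ → ℝ≥0∞) (hv : IsRepulsiveFiniteRange v)
    (hM : ∃ M : ℝ≥0∞, M ≠ ⊤ ∧ ∀ r, v r ≤ M) :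
    ∃ ρ₁ : ℝ, 0 < ρ₁ ∧ ∀ᶠ m : ℕ in Filter.atTop, ∀ ρ : ℝ, 0 < ρ → ρ < ρ₁ → (let N : ℕ := 4 * m ^ 3; let L : ℝ := Literature.MathematicalPhysics.QuantumManyBody.BoseGas.sideLength ρ N; let E : ℝ → Literature.MathematicalPhysics.QuantumManyBody.BoseGas.PeriodicTrialState N L → ENNReal := fun c Ψ => Literature.MathematicalPhysics.QuantumManyBody.BoseGas.periodicEnergy v Ψ + ENNReal.ofReal c * ∫⁻ X in Literature.MathematicalPhysics.QuantumManyBody.BoseGas.cellN N L, ENNReal.ofReal (∑ i, ∑ k : Fin 3, Real.sin (Real.pi * (X i) k * (2 * (m : ℝ)) / L) ^ 2) * (‖Ψ.ψ X‖₊ : ENNReal) ^ 2; let Λ : ℝ → ENNReal := fun c => ⨆ (δ : ENNReal) (_ : 0 < δ), ⨅ (Ψ : Literature.MathematicalPhysics.QuantumManyBody.BoseGas.PeriodicTrialState N L) (_ : E c Ψ ≤ (⨅ Φ : Literature.MathematicalPhysics.QuantumManyBody.BoseGas.PeriodicTrialState N L, E c Φ) + δ), Literature.MathematicalPhysics.QuantumManyBody.BoseGas.maxOccupation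 N ((Literature.MathematicalPhysics.QuantumManyBody.BoseGas.cellN N L).indicator Ψ.ψ); Λ 0 ≤ Literature.Barriers.AtomisticToContinuum.BoseGas.periodicCondensateNumber v N L) := by
  refine ⟨1, one_pos, ?_⟩
  filter_upwards [eventually_ge_atTop 1] with m hm
  intro ρ hρ _
  dsimp only
  simp only [ENNReal.ofReal_zero, zero_mul, add_zero]
  have key := iSup_iInf_maxOccupation_le_periodicCondensateNumber hv hM (4 * m ^ 3 - 1)
    (sideLength_pos_of hρ hm)
  rw [← four_mul_pow_three_eq_succ hm] at key
  simp only [periodicGroundStateEnergy] at key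
  exact key

/-- **The route's `v`-clause from a rigid ground state (any `v`).** If, eventually in `m` and for all
`0 < ρ < ρ₁`, the periodic `4m³`-body problem on the torus of side `L = (4m³/ρ)^{1/3}` admits a
continuous non-negative `Lℤ³`-periodic translation-invariant `Ψ₀` with `∫_cell Ψ₀² ≤ 1` around which
near-minimisers of `𝓔^per_v` are rigid (as in
`iSup_iInf_maxOccupation_le_periodicCondensateNumber_of_rigid`; the particle number is written
`n + 1 = 4m³` to keep the successor form of the tree's slice lemmas), then the `v`-clause of
`ModeIdentification` holds with that `ρ₁`. [cite: LSSY2005, §1.2 (1.17)–(1.19)] -/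
theorem modeIdentification_clause_of_rigid (v : ℝ → ℝ≥0∞)
    (hH : ∃ ρ₁ : ℝ, 0 < ρ₁ ∧ ∀ᶠ m : ℕ in atTop,
      ∀ ρ : ℝ, 0 < ρ → ρ < ρ₁ → ∀ n : ℕ, 4 * m ^ 3 = n + 1 →
        ∃ Ψ₀ : Config (n + 1) → ℝ, Continuous Ψ₀ ∧ (∀ X, 0 ≤ Ψ₀ X) ∧
          (∀ (X : Config (n + 1)) (i : Fin (n + 1)) (k : Fin 3),
            Ψ₀ (X + Pi.single i (EuclideanSpace.single k (sideLength ρ (4 * m ^ 3)))) = Ψ₀ X) ∧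
          (∀ (u : Space) (X : Config (n + 1)), Ψ₀ (X + fun _ => u) = Ψ₀ X) ∧
          (∫⁻ X in cellN (n + 1) (sideLength ρ (4 * m ^ 3)), ENNReal.ofReal (Ψ₀ X) ^ 2 ≤ 1) ∧
          (∀ η : ℝ, 0 < η → ∃ δ : ℝ, 0 < δ ∧
            ∀ Ψ : PeriodicTrialState (n + 1) (sideLength ρ (4 * m ^ 3)),
              periodicEnergy v Ψ ≤
                periodicGroundStateEnergy v (n + 1) (sideLength ρ (4 * m ^ 3)) + ENNReal.ofReal δ →
              ∃ α : ℂ, ‖α‖ ≤ 1 ∧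
                ∫⁻ X in cellN (n + 1) (sideLength ρ (4 * m ^ 3)),
                  (‖Ψ.ψ X - α * Ψ₀ X‖₊ : ℝ≥0∞) ^ 2 ≤ ENNReal.ofReal η)) :
    ∃ ρ₁ : ℝ, 0 < ρ₁ ∧ ∀ᶠ m : ℕ in Filter.atTop, ∀ ρ : ℝ, 0 < ρ → ρ < ρ₁ → (let N : ℕ := 4 * m ^ 3; let L : ℝ := Literature.MathematicalPhysics.QuantumManyBody.BoseGas.sideLength ρ N; let E : ℝ → Literature.MathematicalPhysics.QuantumManyBody.BoseGas.PeriodicTrialState N L → ENNReal := fun c Ψ => Literature.MathematicalPhysics.QuantumManyBody.BoseGas.periodicEnergy v Ψ + ENNReal.ofReal c * ∫⁻ X in Literature.MathematicalPhysics.QuantumManyBody.BoseGas.cellN N L, ENNReal.ofReal (∑ i, ∑ k : Fin 3, Real.sin (Real.pi * (X i) k * (2 * (m : ℝ)) / L) ^ 2) * (‖Ψ.ψ X‖₊ : ENNReal) ^ 2; let Λ : ℝ → ENNReal := fun c => ⨆ (δ : ENNReal) (_ : 0 < δ), ⨅ (Ψ : Literature.MathematicalPhysics.QuantumManyBody.BoseGas.PeriodicTrialState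 N L) (_ : E c Ψ ≤ (⨅ Φ : Literature.MathematicalPhysics.QuantumManyBody.BoseGas.PeriodicTrialState N L, E c Φ) + δ), Literature.MathematicalPhysics.QuantumManyBody.BoseGas.maxOccupation N ((Literature.MathematicalPhysics.QuantumManyBody.BoseGas.cellN N L).indicator Ψ.ψ); Λ 0 ≤ Literature.Barriers.AtomisticToContinuum.BoseGas.periodicCondensateNumber v N L) := by
  obtain ⟨ρ₁, hρ₁, hH⟩ := hH
  refine ⟨ρ₁, hρ₁, ?_⟩
  filter_upwards [hH, eventually_ge_atTop 1] with m hm hm1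
  intro ρ hρ hρ1
  dsimp only
  simp only [ENNReal.ofReal_zero, zero_mul, add_zero]
  obtain ⟨Ψ₀, hcont, hnn, hper, htrans, hnorm, hrig⟩ :=
    hm ρ hρ hρ1 (4 * m ^ 3 - 1) (four_mul_pow_three_eq_succ hm1)
  have key := iSup_iInf_maxOccupation_le_periodicCondensateNumber_of_rigid v (sideLength_pos_of hρ hm1)
    hcont hnn hper htrans hnorm hrig
  rw [← four_mul_pow_three_eq_succ hm1] at key
  simp only [periodicGroundStateEnergy] at key
  exact key

/-- **`ModeIdentification`, conditional on rigid ground states.** If for every repulsive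
finite-range `v` there is `ρ₁ > 0` such that, eventually in `m` and for all `0 < ρ < ρ₁`, the periodic
`4m³`-body problem on the torus of side `(4m³/ρ)^{1/3}` admits a rigid continuous non-negative
`Lℤ³`-periodic translation-invariant ground state (`modeIdentification_clause_of_rigid`; for bounded `v`
this is `exists_rigid_of_bounded` at every `(N, L)`, for hard cores it is the uniqueness of the ground
state of the dilute hard-sphere torus), then the route decl `ModeIdentification` holds.
[cite: LSSY2005, §1.2 (1.17)–(1.19)] -/
theorem modeIdentification_of_rigid
    (H : ∀ v : ℝ → ℝ≥0∞, IsRepulsiveFiniteRange v → ∃ ρ₁ : ℝ, 0 < ρ₁ ∧ ∀ᶠ m : ℕ in atTop,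
      ∀ ρ : ℝ, 0 < ρ → ρ < ρ₁ → ∀ n : ℕ, 4 * m ^ 3 = n + 1 →
        ∃ Ψ₀ : Config (n + 1) → ℝ, Continuous Ψ₀ ∧ (∀ X, 0 ≤ Ψ₀ X) ∧
          (∀ (X : Config (n + 1)) (i : Fin (n + 1)) (k : Fin 3),
            Ψ₀ (X + Pi.single i (EuclideanSpace.single k (sideLength ρ (4 * m ^ 3)))) = Ψ₀ X) ∧
          (∀ (u : Space) (X : Config (n + 1)), Ψ₀ (X + fun _ => u) = Ψ₀ X) ∧
          (∫⁻ X in cellN (n + 1) (sideLength ρ (4 * m ^ 3)), ENNReal.ofReal (Ψ₀ X) ^ 2 ≤ 1) ∧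
          (∀ η : ℝ, 0 < η → ∃ δ : ℝ, 0 < δ ∧
            ∀ Ψ : PeriodicTrialState (n + 1) (sideLength ρ (4 * m ^ 3)),
              periodicEnergy v Ψ ≤
                periodicGroundStateEnergy v (n + 1) (sideLength ρ (4 * m ^ 3)) + ENNReal.ofReal δ →
              ∃ α : ℂ, ‖α‖ ≤ 1 ∧
                ∫⁻ X in cellN (n + 1) (sideLength ρ (4 * m ^ 3)),
                  (‖Ψ.ψ X - α * Ψ₀ X‖₊ : ℝ≥0∞) ^ 2 ≤ ENNReal.ofReal η)) :
    Theses.BECLatticeDepthHomotopy.ModeIdentification :=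
  fun v hv => modeIdentification_clause_of_rigid v (H v hv)

/-- **`ModeIdentification`, conditional on rigid ground states for UNBOUNDED potentials only.** The
bounded case being proved (`modeIdentification_of_bounded`), the route decl `ModeIdentification`
follows from the rigidity hypothesis of `modeIdentification_clause_of_rigid` restricted to the
repulsive finite-range `v` that are NOT bounded (`∀ M < ∞, ∃ r, M < v r`: hard cores `v = ⊤` on a set
of radii, or finite but unbounded profiles) — the exact residual input for the item.
[cite: LSSY2005, §1.2 (1.17)–(1.19)] -/
theorem modeIdentification_of_rigid_unbounded
    (H : ∀ v : ℝ → ℝ≥0∞, IsRepulsiveFiniteRange v → (∀ M : ℝ≥0∞, M ≠ ⊤ → ∃ r, M < v r) → ∃ ρ₁ : ℝ, 0 < ρ₁ ∧ ∀ᶠ m : ℕ in atTop,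
      ∀ ρ : ℝ, 0 < ρ → ρ < ρ₁ → ∀ n : ℕ, 4 * m ^ 3 = n + 1 →
        ∃ Ψ₀ : Config (n + 1) → ℝ, Continuous Ψ₀ ∧ (∀ X, 0 ≤ Ψ₀ X) ∧
          (∀ (X : Config (n + 1)) (i : Fin (n + 1)) (k : Fin 3),
            Ψ₀ (X + Pi.single i (EuclideanSpace.single k (sideLength ρ (4 * m ^ 3)))) = Ψ₀ X) ∧
          (∀ (u : Space) (X : Config (n + 1)), Ψ₀ (X + fun _ => u) = Ψ₀ X) ∧
          (∫⁻ X in cellN (n + 1) (sideLength ρ (4 * m ^ 3)), ENNReal.ofReal (Ψ₀ X) ^ 2 ≤ 1) ∧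
          (∀ η : ℝ, 0 < η → ∃ δ : ℝ, 0 < δ ∧
            ∀ Ψ : PeriodicTrialState (n + 1) (sideLength ρ (4 * m ^ 3)),
              periodicEnergy v Ψ ≤
                periodicGroundStateEnergy v (n + 1) (sideLength ρ (4 * m ^ 3)) + ENNReal.ofReal δ →
              ∃ α : ℂ, ‖α‖ ≤ 1 ∧
                ∫⁻ X in cellN (n + 1) (sideLength ρ (4 * m ^ 3)),
                  (‖Ψ.ψ X - α * Ψ₀ X‖₊ : ℝ≥0∞) ^ 2 ≤ ENNReal.ofReal η)) :
    Theses.BECLatticeDepthHomotopy.ModeIdentification := by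
  intro v hv
  by_cases hb : ∃ M : ℝ≥0∞, M ≠ ⊤ ∧ ∀ r, v r ≤ M
  · exact modeIdentification_of_bounded v hv hb
  · refine modeIdentification_clause_of_rigid v (H v hv fun M hM => ?_)
    by_contra h
    exact hb ⟨M, hM, fun r => not_lt.1 fun hr => h ⟨r, hr⟩⟩

end Summit.AtomisticToContinuum.BoseEinsteinCondensation.Theorems.ModeIdentification

end
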